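import Summits.Ventures.LatticeQCDFlow.Scaling.SimulatedTemperingFiniteSampler
import Summits.Ventures.LatticeQCDFlow.Scaling.LadderPoincare
import Literature.Probability.MarkovChains.AsymptoticVarianceSpectral
import Literature.Probability.MarkovChains.NetworkReduction

/-!
HONEST FRAMING: exact (Metropolis-corrected) sampling algorithms for lattice gauge theory; figures
of merit are autocorrelation/cost numbers at stated couplings and volumes; no continuum-physics
claim.

# SimulatedTemperingFiniteGap — THE CEILING UNDER IMPERFECT WITHIN-LEVEL SAMPLING: ON A FINITE
# CONFIGURATION SPACE THE RANDOM-SCAN SIMULATED-TEMPERING SAMPLER HAS SPECTRAL GAP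
# `≥ min{ta/(3(K+1)²), a(1−t)γ_M/(3(K+1)² + a)}` (`a` ≤ adjacent overlaps, `γ_M` = Poincaré constant of the
# within-level updates), HENCE `asympVar(g) ≤ (2/that − 1)·Var(g)` FOR EVERY OBSERVABLE (lean-2 GEN-16, ours)

Venture-side (OURS).  Cell `lqcd-flow` (pub-lqcd), unit `pub-lqcd-lean-2-g16`, 2026-08-24.  Continues
`Scaling/SimulatedTemperingFiniteSampler` (the sampler `P = stFinSampler t μ M = t·L + (1−t)·W` on
`Fin (K+1) × S`, target `π = stFinLaw μ`, its block structure along the levels).  GEN-13–15 proved, for every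
exact within-level update, the FLOOR `τ_int(level) ≥ K(K+2)/(6tā_K) − ½` (kernel level, general spaces).  Here
is the matching CEILING, which must and does depend on the within-level update through ONE number: a uniform
Poincaré constant `γ_M` of the `M_k` (`γ_M·Var_{μ_k}(h) ≤ 𝓔_{μ_k}(M_k; h)` for all `h`, all `k`).

## What is proved (finite-chain vocabulary of `Literature.Probability.MarkovChains`)

* (`Scaling/LadderPoincare`: `Var_unif(g) ≤ ((K+1)/2)·Σ_{k<K}(g_{k+1} − g_k)²` on the ladder.)
* §2 **`stFin_projection_poincare`** — the projection chain (lazy overlap ladder walk) satisfies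
  `(ta/(K+1)²)·Var_π̄(g) ≤ 𝓔_π̄(P̄; g)` when `a ≤` every adjacent overlap; `stFin_restriction_poincare` — the
  restriction chains satisfy `(1−t)γ_M·Var ≤ 𝓔`.
* §3 **`stFinSampler_isIrreducible`** — the sampler is irreducible as soon as every `M_k` is (`0 < t < 1`).
* §4 **`stFin_spectralGap_ge`** — Jerrum–Son–Tetali–Vigoda Theorem 1 (Literature, PROVED there) with the
  levels as blocks: **`Gap(P) ≥ min{ta/(3(K+1)²), a(1−t)γ_M/(3(K+1)² + a)}`** (`0 < t < 1`, `0 < a`,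
  `0 < γ_M`, `K ≥ 1`); **`stFin_asympVar_le`** — by the Madras–Slade sandwich (Literature
  `asympVar_le_spectralGap`), for EVERY observable `g` of the chain, `asympVar g π P ≤ (2/c − 1)·Var_π(g)` with
  `c` that bound: `τ_int(g) = asympVar/(2Var) ≤ 1/c − ½ = O((K+1)²/(a·γ_M))` — the diffusive ladder law TIMES
  the within-level relaxation, against the floor `Θ(K²/ā)`.  With perfect within-level sampling (`γ_M = 1`,
  `Scaling/SimulatedTemperingFiniteCeiling`) the two sides agree up to constants; an imperfect sampler with a
  volume- or coupling-dependent `γ_M` inflates the ceiling by exactly `1/γ_M`.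

NOT CLAIMED: sharp constants (the ladder Poincaré constant here is `ta/(K+1)²`; the truth for equal overlaps is
`≈ π²ta/(2(K+1)²)`; JSTV's `1/3` is generic); that the product form `K²/(aγ_M)` is attained (decomposition
bounds multiply the two relaxation times; the truth can be their maximum); general configuration spaces;
deterministic scans; replica exchange (needs tensorisation of the Poincaré inequality for the product replica
update — not in the tree); anything measured.  Literature grade (cell rule): KNOWN MECHANISM (Madras–Randall
2002 Thm 1.1/2.1, Woodard–Schmidler–Huber 2009 — decomposition lower bounds for tempering gaps; here via
Jerrum–Son–Tetali–Vigoda 2004 Thm 1, PROVED in the tree), NEW TYPING (explicit constants for the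
nearest-neighbour Metropolis ladder with exact weights, the `asympVar` ceiling for every observable); nothing
cited as a fact; no new bib keys.
-/

noncomputable section

open Finset
open Literature.Probability.MarkovChains
open Literature.Probability.MarkovChains.Decomposition

namespace Summit.Ventures.LatticeQCDFlow.Scaling

/-! ## §2 Poincaré constants of the projection chain and of the restriction chains -/

section Blocks

variable {S : Type*} [Fintype S] [DecidableEq S] {K : ℕ} {μ : Fin (K + 1) → S → ℝ}
  {M : Fin (K + 1) → Matrix S S ℝ} {t : ℝ}

omit [DecidableEq S] in
/-- The overlap is symmetric. [ours] -/
theorem stFinOverlap_comm (μ : Fin (K + 1) → S → ℝ) (i j : Fin (K + 1)) :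
    stFinOverlap μ i j = stFinOverlap μ j i := by
  unfold stFinOverlap
  exact sum_congr rfl fun x _ => min_comm _ _

omit [DecidableEq S] in
/-- An overlap is at most `1` (the level laws are probability vectors). [ours] -/
theorem stFinOverlap_le_one (hμ1 : ∀ k, ∑ x, μ k x = 1) (i j : Fin (K + 1)) : stFinOverlap μ i j ≤ 1 := by
  unfold stFinOverlap
  rw [← hμ1 i]
  exact sum_le_sum fun x _ => min_le_left _ _

/-- Termwise: the flow `π̄(i)P̄(i,j)(g i − g j)²` dominates `(ta/(2(K+1)))·([j = i+1] + [i = j+1])·(g i − g j)²`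
when `a ≤` every adjacent overlap. [ours] -/
theorem stFin_blockFlow_mul_sq_ge (hμ : ∀ k x, 0 < μ k x) (ht0 : 0 ≤ t) {a : ℝ}
    (hov : ∀ i j : Fin (K + 1), (j.val = i.val + 1 ∨ i.val = j.val + 1) → a ≤ stFinOverlap μ i j)
    (g : Fin (K + 1) → ℝ) (i j : Fin (K + 1)) :
    t * a / (2 * (K + 1)) * ((if j.val = i.val + 1 then (g i - g j) ^ 2 else 0)
        + (if i.val = j.val + 1 then (g i - g j) ^ 2 else 0))
      ≤ blockFlow (stFinLaw μ) (stFinSampler t μ M) Prod.fst i j * (g i - g j) ^ 2 := by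
  by_cases hij : i = j
  · subst hij
    simp
  rw [stFin_blockFlow_of_ne hμ hij]
  by_cases hadj : (j.val = i.val + 1 ∨ i.val = j.val + 1)
  · rw [if_pos hadj]
    have hone : (if j.val = i.val + 1 then (g i - g j) ^ 2 else 0)
        + (if i.val = j.val + 1 then (g i - g j) ^ 2 else 0) = (g i - g j) ^ 2 := by
      rcases hadj with h | h
      · rw [if_pos h, if_neg (by omega), add_zero]
      · rw [if_neg (by omega), if_pos h, zero_add]
    rw [hone]
    refine mul_le_mul_of_nonneg_right ?_ (sq_nonneg _)
    rw [mul_div_assoc, mul_div_assoc]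
    exact mul_le_mul_of_nonneg_left (div_le_div_of_nonneg_right (hov i j hadj) (by positivity)) ht0
  · rw [if_neg hadj, zero_mul]
    have h1 : ¬ j.val = i.val + 1 := fun h => hadj (Or.inl h)
    have h2 : ¬ i.val = j.val + 1 := fun h => hadj (Or.inr h)
    rw [if_neg h1, if_neg h2, add_zero, mul_zero]

/-- The Dirichlet form of the projection chain dominates `(ta/(2(K+1)))·Σ_{k<K}(g(k+1) − g(k))²`. [ours] -/
theorem stFin_projection_dirichletForm_ge (hμ : ∀ k x, 0 < μ k x) (hμ1 : ∀ k, ∑ x, μ k x = 1)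
    (ht0 : 0 ≤ t) {a : ℝ}
    (hov : ∀ i j : Fin (K + 1), (j.val = i.val + 1 ∨ i.val = j.val + 1) → a ≤ stFinOverlap μ i j)
    (g : Fin (K + 1) → ℝ) :
    t * a / (2 * (K + 1)) * ∑ k : Fin K, (g k.succ - g k.castSucc) ^ 2
      ≤ dirichletForm (blockMass (stFinLaw μ) Prod.fst)
          (projectionChain (stFinLaw μ) (stFinSampler t μ M) Prod.fst) g := by
  have hM : ∀ i, blockMass (stFinLaw μ) Prod.fst i ≠ 0 := fun i => by
    rw [stFin_blockMass hμ1]; positivity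
  unfold dirichletForm
  simp_rw [blockMass_mul_projectionChain (hM _)]
  have hsum := Finset.sum_le_sum fun i (_ : i ∈ (univ : Finset (Fin (K + 1)))) =>
    Finset.sum_le_sum fun j (_ : j ∈ (univ : Finset (Fin (K + 1)))) =>
      stFin_blockFlow_mul_sq_ge (M := M) hμ ht0 hov g i j
  have hL : ∑ i : Fin (K + 1), ∑ j : Fin (K + 1), t * a / (2 * (K + 1))
      * ((if j.val = i.val + 1 then (g i - g j) ^ 2 else 0) + (if i.val = j.val + 1 then (g i - g j) ^ 2 else 0))
      = t * a / (2 * (K + 1)) * (2 * ∑ k : Fin K, (g k.succ - g k.castSucc) ^ 2) := by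
    simp_rw [← Finset.mul_sum, Finset.sum_add_distrib]
    rw [sum_sum_ite_val_succ (fun i j => (g i - g j) ^ 2), sum_sum_ite_val_pred (fun i j => (g i - g j) ^ 2)]
    congr 1
    rw [two_mul]
    congr 1
    exact sum_congr rfl fun k _ => by ring
  rw [hL] at hsum
  have ha : t * a / (2 * (K + 1)) * ∑ k : Fin K, (g k.succ - g k.castSucc) ^ 2
      = 1 / 2 * (t * a / (2 * (K + 1)) * (2 * ∑ k : Fin K, (g k.succ - g k.castSucc) ^ 2)) := by ring
  rw [ha]
  exact mul_le_mul_of_nonneg_left hsum (by norm_num)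

/-- **Poincaré inequality for the projection chain:** `(ta/(K+1)²)·Var_π̄(g) ≤ 𝓔_π̄(P̄; g)` when `a ≤` every
adjacent overlap (`π̄` = the uniform block masses). [ours] -/
theorem stFin_projection_poincare (hμ : ∀ k x, 0 < μ k x) (hμ1 : ∀ k, ∑ x, μ k x = 1) (ht0 : 0 ≤ t)
    {a : ℝ} (ha0 : 0 ≤ a)
    (hov : ∀ i j : Fin (K + 1), (j.val = i.val + 1 ∨ i.val = j.val + 1) → a ≤ stFinOverlap μ i j)
    (g : Fin (K + 1) → ℝ) :
    t * a / (K + 1) ^ 2 * lawVariance (blockMass (stFinLaw μ) Prod.fst) g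
      ≤ dirichletForm (blockMass (stFinLaw μ) Prod.fst)
          (projectionChain (stFinLaw μ) (stFinSampler t μ M) Prod.fst) g := by
  have hunif : blockMass (stFinLaw μ) (Prod.fst : Fin (K + 1) × S → Fin (K + 1))
      = fun _ => (1 : ℝ) / (K + 1) := funext fun i => stFin_blockMass hμ1 i
  have hvar := lawVariance_uniform_le_ladder K g
  rw [← hunif] at hvar
  refine le_trans ?_ (stFin_projection_dirichletForm_ge hμ hμ1 ht0 hov g)
  calc t * a / (K + 1) ^ 2 * lawVariance (blockMass (stFinLaw μ) Prod.fst) g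
      ≤ t * a / (K + 1) ^ 2 * (((K + 1 : ℝ) / 2) * ∑ k : Fin K, (g k.succ - g k.castSucc) ^ 2) :=
        mul_le_mul_of_nonneg_left hvar (by positivity)
    _ = t * a / (2 * (K + 1)) * ∑ k : Fin K, (g k.succ - g k.castSucc) ^ 2 := by
        field_simp

/-- **Poincaré inequality for the restriction chains:** a uniform Poincaré constant `γ_M` of the within-level
updates gives `(1 − t)γ_M·Var_{π_k}(f) ≤ 𝓔_{π_k}(P_k; f)` on every level (`t ≤ 1`). [ours] -/
theorem stFin_restriction_poincare (hμ1 : ∀ k, ∑ x, μ k x = 1) (ht1 : t ≤ 1) {γ : ℝ}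
    (hgap : ∀ k, ∀ h : S → ℝ, γ * lawVariance (μ k) h ≤ dirichletForm (μ k) (M k) h)
    (k : Fin (K + 1)) (f : Fin (K + 1) × S → ℝ) :
    (1 - t) * γ * lawVariance (blockLaw (stFinLaw μ) Prod.fst k) f
      ≤ dirichletForm (blockLaw (stFinLaw μ) Prod.fst k) (restrictionChain (stFinSampler t μ M) Prod.fst) f := by
  rw [stFin_lawVariance_blockLaw hμ1, stFin_dirichletForm_restriction hμ1, mul_assoc]
  exact mul_le_mul_of_nonneg_left (hgap k _) (by linarith)

/-! ## §3 Irreducibility -/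

/-- **The sampler is irreducible when every within-level update is** (`0 < t < 1`, positive level laws):
within a level `M_k` connects everything, and the Metropolis level move has positive probability between
adjacent levels at every configuration. [ours] -/
theorem stFinSampler_isIrreducible (hμ : ∀ k x, 0 < μ k x) (hM : ∀ k, IsRowStochastic (M k))
    (hMirr : ∀ k, IsIrreducible (M k)) (ht0 : 0 < t) (ht1 : t < 1) :
    IsIrreducible (stFinSampler t μ M) := by
  have hP0 := (stFinSampler_isRowStochastic hμ hM ht0.le ht1.le).1
  have hL0 := (stFinLevel_isRowStochastic hμ).1
  refine isIrreducible_of_forall_closed hP0 fun T hT hcl => ?_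
  -- a level that meets `T` lies in `T`
  have full : ∀ k : Fin (K + 1), (∃ x, (k, x) ∈ T) → ∀ y, (k, y) ∈ T := by
    intro k ⟨x, hx⟩ y
    set Tk : Finset S := univ.filter fun z => (k, z) ∈ T with hTk
    have hcl' : ∀ z ∈ Tk, ∀ w, 0 < M k z w → w ∈ Tk := by
      intro z hz w hzw
      rw [hTk, Finset.mem_filter] at hz ⊢
      refine ⟨mem_univ _, hcl (k, z) hz.2 (k, w) ?_⟩
      rw [stFinSampler_apply, stFinWithin_apply, if_pos rfl]
      have : 0 < (1 - t) * M k z w := mul_pos (by linarith) hzw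
      linarith [mul_nonneg ht0.le (hL0 (k, z) (k, w))]
    have hx' : x ∈ Tk := by rw [hTk, Finset.mem_filter]; exact ⟨mem_univ _, hx⟩
    have hTk' := (hMirr k).eq_univ_of_closed (hM k).1 ⟨x, hx'⟩ hcl'
    have hy : y ∈ Tk := by rw [hTk']; exact mem_univ _
    rw [hTk, Finset.mem_filter] at hy
    exact hy.2
  -- a full level fills its neighbours
  have step : ∀ k l : Fin (K + 1), (l.val = k.val + 1 ∨ k.val = l.val + 1) →
      (∀ y, (k, y) ∈ T) → ∀ y, (l, y) ∈ T := by
    intro k l hkl hk y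
    refine full l ⟨y, hcl (k, y) (hk y) (l, y) ?_⟩ y
    have hlk : ((l, y) : Fin (K + 1) × S) ≠ (k, y) := fun e => by
      have := (Prod.mk.inj e).1; subst this; omega
    have hflow := stFinLaw_mul_stFinLevel hμ hlk
    rw [if_pos ⟨rfl, hkl⟩] at hflow
    have hpos : 0 < stFinLaw μ (k, y) * stFinLevel μ (k, y) (l, y) := by
      rw [hflow]; exact div_pos (lt_min (hμ k y) (hμ l y)) (by positivity)
    have hLpos : 0 < stFinLevel μ (k, y) (l, y) := (mul_pos_iff_of_pos_left (stFinLaw_pos hμ _)).mp hpos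
    rw [stFinSampler_apply]
    have hW := (stFinWithin_isRowStochastic hM).1 (k, y) (l, y)
    nlinarith [mul_pos ht0 hLpos]
  obtain ⟨⟨k₀, x₀⟩, h0⟩ := hT
  have hk₀ : ∀ y, (k₀, y) ∈ T := full k₀ ⟨x₀, h0⟩
  have up : ∀ d : ℕ, ∀ h : k₀.val + d < K + 1, ∀ y, ((⟨k₀.val + d, h⟩ : Fin (K + 1)), y) ∈ T := by
    intro d
    induction d with
    | zero => intro h y; exact hk₀ y
    | succ d ih =>
      intro h y
      exact step ⟨k₀.val + d, by omega⟩ ⟨k₀.val + (d + 1), h⟩ (Or.inl (by simp; omega))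
        (ih (by omega)) y
  have down : ∀ d : ℕ, ∀ h : d ≤ k₀.val, ∀ y, ((⟨k₀.val - d, by omega⟩ : Fin (K + 1)), y) ∈ T := by
    intro d
    induction d with
    | zero => intro h y; exact hk₀ y
    | succ d ih =>
      intro h y
      exact step ⟨k₀.val - d, by omega⟩ ⟨k₀.val - (d + 1), by omega⟩ (Or.inr (by simp; omega))
        (ih (by omega)) y
  refine Finset.eq_univ_of_forall fun p => ?_
  obtain ⟨l, y⟩ := p
  by_cases h : k₀.val ≤ l.val
  · have e : l = ⟨k₀.val + (l.val - k₀.val), by omega⟩ := Fin.ext (by simp; omega)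
    rw [e]; exact up _ _ y
  · have e : l = ⟨k₀.val - (k₀.val - l.val), by omega⟩ := Fin.ext (by simp; omega)
    rw [e]; exact down _ (by omega) y

/-! ## §4 The spectral gap and the asymptotic-variance ceiling -/

/-- **THE SPECTRAL GAP OF THE SAMPLER UNDER IMPERFECT WITHIN-LEVEL SAMPLING** (Jerrum–Son–Tetali–Vigoda
Theorem 1 with the levels as blocks): `a ≤` adjacent overlaps, `γ_M` a uniform Poincaré constant of the
within-level updates, `0 < t < 1`, `K ≥ 1` ⇒
`min{ta/(3(K+1)²), a(1−t)γ_M/(3(K+1)² + a)} ≤ Gap(stFinSampler t μ M)`. [ours] -/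
theorem stFin_spectralGap_ge (hK : 1 ≤ K) (hμ : ∀ k x, 0 < μ k x) (hμ1 : ∀ k, ∑ x, μ k x = 1)
    (hM : ∀ k, IsRowStochastic (M k)) (hMrev : ∀ k, DetailedBalance (μ k) (M k))
    (ht0 : 0 < t) (ht1 : t < 1) {a γ : ℝ} (ha : 0 < a) (hγ : 0 < γ)
    (hov : ∀ i j : Fin (K + 1), (j.val = i.val + 1 ∨ i.val = j.val + 1) → a ≤ stFinOverlap μ i j)
    (hgap : ∀ k, ∀ h : S → ℝ, γ * lawVariance (μ k) h ≤ dirichletForm (μ k) (M k) h) :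
    min (t * a / (3 * (K + 1) ^ 2)) (a * (1 - t) * γ / (3 * (K + 1) ^ 2 + a))
      ≤ spectralGap (stFinLaw μ) (stFinSampler t μ M) := by
  haveI : Nonempty S := by
    by_contra h
    rw [not_nonempty_iff] at h
    have := hμ1 0
    rw [Finset.univ_eq_empty, Finset.sum_empty] at this
    exact zero_ne_one this
  haveI : Nontrivial (Fin (K + 1)) := Fin.nontrivial_iff_two_le.mpr (by omega)
  have hsurj : Function.Surjective (Prod.fst : Fin (K + 1) × S → Fin (K + 1)) := Prod.fst_surjective
  have hlamP : 0 < t * a / (K + 1) ^ 2 := by positivity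
  have hlamMin : 0 < (1 - t) * γ := mul_pos (by linarith) hγ
  have key := JerrumEtAl2004_thm_1_spectralGap (stFinLaw_pos hμ) (sum_stFinLaw hμ1)
    (stFinSampler_isRowStochastic hμ hM ht0.le ht1.le) (stFinSampler_detailedBalance hμ hMrev) hsurj
    hlamP hlamMin ht0.le (stFin_projection_poincare (M := M) hμ hμ1 ht0.le ha.le hov)
    (stFin_restriction_poincare hμ1 ht1.le hgap) (stFin_escapeProb_le (M := M) hμ ht0.le)
  refine le_trans (le_of_eq ?_) key
  have hK1 : (K + 1 : ℝ) ^ 2 ≠ 0 := by positivity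
  have h3 : (3 * t + t * a / (K + 1) ^ 2 : ℝ) ≠ 0 := by positivity
  have h4 : (3 * (K + 1) ^ 2 + a : ℝ) ≠ 0 := by positivity
  congr 1
  · rw [div_div]
    ring
  · rw [div_eq_div_iff h4 (by positivity)]
    field_simp

/-- **THE CEILING: the asymptotic variance of EVERY observable of the sampler** is at most
`(2/c − 1)·Var_π(g)`, `c = min{ta/(3(K+1)²), a(1−t)γ_M/(3(K+1)² + a)}` — i.e. `τ_int(g) ≤ 1/c − ½`
(irreducible within-level updates). [ours] -/
theorem stFin_asympVar_le (hK : 1 ≤ K) (hμ : ∀ k x, 0 < μ k x) (hμ1 : ∀ k, ∑ x, μ k x = 1)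
    (hM : ∀ k, IsRowStochastic (M k)) (hMrev : ∀ k, DetailedBalance (μ k) (M k))
    (hMirr : ∀ k, IsIrreducible (M k)) (ht0 : 0 < t) (ht1 : t < 1) {a γ : ℝ} (ha : 0 < a) (hγ : 0 < γ)
    (hov : ∀ i j : Fin (K + 1), (j.val = i.val + 1 ∨ i.val = j.val + 1) → a ≤ stFinOverlap μ i j)
    (hgap : ∀ k, ∀ h : S → ℝ, γ * lawVariance (μ k) h ≤ dirichletForm (μ k) (M k) h)
    (g : Fin (K + 1) × S → ℝ) :
    asympVar g (stFinLaw μ) (stFinSampler t μ M)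
      ≤ (2 / min (t * a / (3 * (K + 1) ^ 2)) (a * (1 - t) * γ / (3 * (K + 1) ^ 2 + a)) - 1)
          * lawVariance (stFinLaw μ) g := by
  haveI : Nonempty S := by
    by_contra h
    rw [not_nonempty_iff] at h
    have := hμ1 0
    rw [Finset.univ_eq_empty, Finset.sum_empty] at this
    exact zero_ne_one this
  haveI : Nontrivial (Fin (K + 1)) := Fin.nontrivial_iff_two_le.mpr (by omega)
  have hP := stFinSampler_isRowStochastic hμ hM ht0.le ht1.le
  have hDB := stFinSampler_detailedBalance (t := t) hμ hMrev
  have hirr := stFinSampler_isIrreducible hμ hM hMirr ht0 ht1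
  have h1 := asympVar_le_spectralGap (stFinLaw_pos hμ) (sum_stFinLaw hμ1) hP hDB hirr g
  have hc := stFin_spectralGap_ge hK hμ hμ1 hM hMrev ht0 ht1 ha hγ hov hgap
  have hcpos : 0 < min (t * a / (3 * (K + 1) ^ 2)) (a * (1 - t) * γ / (3 * (K + 1) ^ 2 + a)) :=
    lt_min (by positivity) (by apply div_pos (mul_pos (mul_pos ha (by linarith)) hγ); positivity)
  refine h1.trans (mul_le_mul_of_nonneg_right ?_ (lawVariance_nonneg (fun p => (stFinLaw_pos hμ p).le) g))
  have := div_le_div_of_nonneg_left (by norm_num : (0 : ℝ) ≤ 2) hcpos hc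
  linarith

end Blocks

end Summit.Ventures.LatticeQCDFlow.Scaling

end
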